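import Summits.Ventures.PercRepro.S1FiveCircuitBase
import Summits.Ventures.PercRepro.S1CoreCapChain

/-!
# PercRepro — THE COLOOP-FREE CAPS: `s₄ ≤ ⌊n·avgChain(d−1)/(n − 4)⌋` AND `s₅ ≤ ⌊n·avgChain5b(d−1)/(n − 5)⌋` ON A COLOOP-FREE CORE WITH `n` ELEMENTS (p7, gen 7; sub-claim S2; generic)

p2's averaging steps (`S1.ncard_fourCircuits_sub_div_le_of_nonColoops`, `S1.ncard_fiveCircuits_sub_div_le_of_nonColoops`) run with
`m` = any lower bound on the number of non-coloops; the chains of record take `m ≥ d + 5` (the non-coloop part has rank `≥ 5`).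
On a COLOOP-FREE core every one of the `n = |E|` elements is a non-coloop, so the same steps run with `m = n`:
`s₄ ≤ ⌊n·avgChain(d − 1)/(n − 4)⌋` and `s₅ ≤ ⌊n·avgChain5b(d − 1)/(n − 5)⌋` at nullity `d` — e.g. `63` in place of `79` at
`(p, d) = (18, 7)` (`n = 25`), `38` in place of `53` at `(17, 6)`, `24` in place of `32` at S1's `(11, 5)`. With the coloop step
`ThmN.rls_of_isColoop_scaled` (S2ColoopScaled) this is the coloop split of the cell `(18, 7)` (S2CoreEighteenSeven), made generic:
**`ncard_fourCircuits_le_of_no_coloop`**, **`ncard_fiveCircuits_le_of_no_coloop`**. Axioms: standard.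
-/

open scoped Matroid

namespace PercRepro

namespace S2

open Set

variable {α : Type}

/-- A coloop-free matroid has `M.coloops = ∅`. -/
theorem coloops_eq_empty_of_forall_not (M : Matroid α) (hK : ∀ e, ¬ M.IsColoop e) : M.coloops = ∅ := by
  ext x
  simp only [Set.mem_empty_iff_false, iff_false]
  intro hx
  exact hK x ((Matroid.isColoop_iff_mem_coloops).2 hx)

/-- **The coloop-free `4`-circuit cap**: on an `e`-free core of nullity `d + 1` with no coloop and `n > 4` elements,
`s₄ ≤ ⌊n·avgChain d/(n − 4)⌋` (p2's averaging step with `m = n`). -/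
theorem ncard_fourCircuits_le_of_no_coloop (M : Matroid α) [M.Finite]
    (hfree : ∀ e ∈ M.E, ∃ A ⊆ M.E \ {e}, e ∉ M.closure A ∧ e ∉ M.closure ((M.E \ {e}) \ A))
    {d : ℕ} (hd : M.E.encard = M.eRank + ((d : ℕ) + 1)) (hK : ∀ e, ¬ M.IsColoop e) (hn : 4 < M.E.ncard) :
    {C : Set α | M.IsCircuit C ∧ C.ncard = 4}.ncard ≤ M.E.ncard * S1.avgChain d / (M.E.ncard - 4) := by
  have hm : M.E.ncard ≤ (M.E \ M.coloops).ncard := by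
    rw [coloops_eq_empty_of_forall_not M hK, Set.sdiff_empty]
  have h := S1.ncard_fourCircuits_sub_div_le_of_nonColoops M hfree hd (by omega) hm (B := S1.avgChain d)
    (fun M' _ hfree' hd' => S1.ncard_fourCircuits_le_avgChain d M' hfree' hd')
  exact S1.le_mul_div_of_sub_div_le hn h

/-- **The coloop-free `5`-circuit cap**: on an `e`-free core of nullity `d + 1` with no coloop and `n > 5` elements,
`s₅ ≤ ⌊n·avgChain5b d/(n − 5)⌋` (p2's five-circuit averaging step with `m = n`). -/
theorem ncard_fiveCircuits_le_of_no_coloop (M : Matroid α) [M.Finite]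
    (hfree : ∀ e ∈ M.E, ∃ A ⊆ M.E \ {e}, e ∉ M.closure A ∧ e ∉ M.closure ((M.E \ {e}) \ A))
    {d : ℕ} (hd : M.E.encard = M.eRank + ((d : ℕ) + 1)) (hK : ∀ e, ¬ M.IsColoop e) (hn : 5 < M.E.ncard) :
    {C : Set α | M.IsCircuit C ∧ C.ncard = 5}.ncard ≤ M.E.ncard * S1.avgChain5b d / (M.E.ncard - 5) := by
  have hm : M.E.ncard ≤ (M.E \ M.coloops).ncard := by
    rw [coloops_eq_empty_of_forall_not M hK, Set.sdiff_empty]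
  have h := S1.ncard_fiveCircuits_sub_div_le_of_nonColoops M hfree hd (by omega) hm (B := S1.avgChain5b d)
    (fun M' _ hfree' hd' => S1.ncard_fiveCircuits_le_avgChain5b d M' hfree' hd')
  exact S1.le_mul_div_of_sub_div_le_five hn h

/-- The values at `(18, 7)`: `s₄ ≤ 63`, `s₅ ≤ 292` on a coloop-free core with `25` elements and nullity `7`. -/
theorem caps_twentyfive_seven : 25 * S1.avgChain 6 / (25 - 4) = 63 ∧ 25 * S1.avgChain5b 6 / (25 - 5) = 292 := by
  decide +kernel

end S2

end PercRepro
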